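import Summits.HodgeConjecture.HodgeConjecture.Theses.EndoscopicMiddleDegree
import Literature.AlgebraicGeometry.HodgeTheory.SupportedClassesIrreducible
import HarnessLib

/-!
# Route EndoscopicMiddleDegree · `CupProductAlgebraic` (stmt-HodgeConjecture-14350) modulo the
# moving of IRREDUCIBLE supports

The item `CupProductAlgebraic` (`Nˡ H²ˡ ∪ Nᵏ H²ᵏ ⊆ N^{l+k} H^{2(l+k)}` on every smooth projective
`X/ℂ`; Voisin II Prop. 9.20 on the coniveau carrier) is reduced in the tree to a MOVING hypothesis
(`cupProduct_mem_algebraicClasses_of_moving`, `AlgebraicClassesCup`) and, by the support half of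
purity proved in `SupportedClassesIrreducible` (`algebraicClasses_eq_iSup_isIrreducible`,
`cupProduct_mem_algebraicClasses_of_moving_isIrreducible`), to the same hypothesis for IRREDUCIBLE
supports only. This file records the item CLOSED MODULO exactly that residual input, stated INLINE as the
hypothesis of `cupProductAlgebraic_of_moving_isIrreducible` — the printed content of Chow's moving lemma for a
prime cycle against a subvariety (Fulton 1998 §11.4; Roberts 1972; Voisin II Lemma 9.22) together
with the cycle class through rational equivalence (Voisin II Lemma 9.18), read on supports: "every
class of `H²ˡ(X(ℂ); ℂ)` dying off an irreducible closed `Z` of codimension `≥ l` is a sum of classes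
dying off closed `T` which meet the irreducible closed `W` (codimension `≥ k`) in codimension
`≥ l + k`". It is NOT a named fact of the tree (D-0026: a theory, not a lemma — it is to be
CONSTRUCTED, see the module docstring of `AlgebraicClassesCup`), so the result is conditional and the
item stays open; the point of the file is to pin the residual debt to one Lean term.
Prover seat prover-pitem-stmt-HodgeConjecture-14350-0.
-/

noncomputable section

namespace Summit.HodgeConjecture.HodgeConjecture.Theorems.EndoscopicMiddleDegree

open Literature.AlgebraicGeometry Literature.AlgebraicGeometry.HodgeTheory
open Literature.AlgebraicTopology.SingularHomology

/-- **`CupProductAlgebraic` modulo the moving of irreducible supports** (conditional; the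
hypothesis is the residual input of the item on the tree's carriers, deliberately NOT a named fact —
D-0026: it is to be constructed, see the module docstring of `AlgebraicClassesCup`): IF on every
smooth projective `X/ℂ`, for an IRREDUCIBLE Zariski-closed `Z` with all points of codimension `≥ l`
and an IRREDUCIBLE Zariski-closed `W` with all points of codimension `≥ k`, every class of
`H²ˡ(X(ℂ); ℂ)` dying on `(X ∖ Z)(ℂ)` lies in the span of the classes dying on `(X ∖ T)(ℂ)` for
closed `T` meeting `W` in codimension `≥ l + k` everywhere (in print: purity `ker = ℂ · cl(Z)`,
Fulton §19.1; Chow's moving lemma `Z ∼ Σ mᵢ Zᵢ'` with each `Zᵢ'` meeting `W` properly, Fulton §11.4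
/ Roberts 1972 / Voisin II Lemma 9.22; `cl(Z) = Σ mᵢ cl(Zᵢ')`, Voisin II Lemma 9.18; when `Z ∩ W`
is already proper `T = Z` works), THEN `CupProductAlgebraic` — by
`cupProduct_mem_algebraicClasses_of_moving_isIrreducible` (`SupportedClassesIrreducible`: the support
half of purity + the cup product with supports). [cite: VoisinHodgeII2003, §9.2.4 Prop. 9.20 and Lemma 9.22]
[cite: Fulton1998, §19.2 Cor. 19.2 and §11.4 Moving Lemma] -/
theorem cupProductAlgebraic_of_moving_isIrreducible
    (hmove : ∀ ⦃n : ℕ⦄ ⦃X : Motives.SchemeOver ℂ⦄, Motives.IsSmoothProjective n X → ∀ (l k : ℕ)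
      ⦃Z W : Set X.left⦄, IsClosed Z → IsIrreducible Z → (∀ z ∈ Z, (l : ℕ∞) ≤ Order.coheight z) →
        IsClosed W → IsIrreducible W → (∀ w ∈ W, (k : ℕ∞) ≤ Order.coheight w) →
          LinearMap.ker (complexBetti.restrictCompl X Z (2 * l)).hom ≤
            ⨆ (T : Set X.left) (_ : IsClosed T)
              (_ : ∀ t ∈ T ∩ W, ((l + k : ℕ) : ℕ∞) ≤ Order.coheight t),
              LinearMap.ker (complexBetti.restrictCompl X T (2 * l)).hom) :
    Summit.HodgeConjecture.HodgeConjecture.Theses.EndoscopicMiddleDegree.CupProductAlgebraic := by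
  intro n X hX l k a b ha hb
  exact cupProduct_mem_algebraicClasses_of_moving_isIrreducible hX (hmove hX l k) ha hb

end Summit.HodgeConjecture.HodgeConjecture.Theorems.EndoscopicMiddleDegree

end
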